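import Summits.NavierStokesRegularity.NavierStokesRegularity.Theorems.TerminalTraceTypeITraceScarL3NoConcentration
import Literature.Analysis.FluidPDE.NSViscosityRescaling
import Literature.Analysis.FluidPDE.NSLerayHopfABCScaling

set_option linter.dupNamespace false

/-!
# No local `L²` concentration at the final time under a MORREY bound alone (Type I in the scaled-energy
# sense) — nsreg-C26-p1 g3

`…NoConcentration.lean` / `…NoConcentrationViscosity.lean` prove: Type I in TIME at `T` ⇒ `u(t) → u(T)` in
`L²_loc` strongly (known in substance in global form, Leslie–Shvydkoy 2018 Thm. 1.2).  The proof used the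
Type-I hypothesis ONLY through the Morrey bound of the slices near `T` (`morrey_of_typeI`:
`∫_{B(x,ρ)} |u(t)|² ≤ M₀ ρ` for `T_M < t < T`, `ρ ≤ r_M`, every centre).  This file records the statement
under that WEAKER hypothesis — Type I in the sense of CKN's scaled kinetic energy `sup_{z,r} A(r,z) < ∞`
near the final time (Albritton–Barker 2019's local Type-I class restricted to the `A`-functional), with NO
pointwise rate:

* `localEnergy_sub_top_le_of_morrey_unit` (`ν = 1`) and `localEnergy_sub_top_le_of_morrey` (every `ν`,
  Tao's normalisation): classical on `[0,T)` + Leray–Hopf on `[0,T]` + the Morrey bound near `T` ⇒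
  `∀ x₀ R θ>0 ∃ t₀<T ∀ t∈(t₀,T), ∫_{B(x₀,R)} |u(t) − u(T)|² ≤ θ`;
* `tendsto_localEnergy_sub_top_of_morrey` — the `Tendsto` form.

Proof = the CKN-slice route verbatim (weak lsc of the Morrey bound at `T`, `ℋ¹`-null compact top singular
set on the Tao-gauged pair, Federer cover, Lipschitz slices at regular top points).  IN PRINT IN SUBSTANCE:
Leslie–Shvydkoy 2018 prove their Thm. 1.2 precisely THROUGH this class — «Type-I in time ⇒ Type-I in space
(`u ∈ L^∞ 𝓜^{2,1}`) ⇒ energy equality» (§4: Cannone's theorem and interpolation into the Onsager-critical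
`L³B^{1/3}_{3,3}`); the small-radius Morrey bound below together with the Leray–Hopf energy bound is their
`𝓜^{2,1}` hypothesis.  So this file is a formal proof, by a different route, of (a local form of) their
intermediate step — not a new result [cite: LeslieShvydkoy2017, §4 and Thm. 1.2].  The Morrey class is
implied by the pointwise rate (Albritton–Barker 2019, Lemma 2.5) and not conversely.  WHAT THIS IS NOT: not 18385, not a Type-I exclusion,
NOT Navier–Stokes regularity.  [cite: CaffarelliKohnNirenberg1982, Thm B; AlbrittonBarker2019, Def. 2.1, Lemma 2.5;
LeslieShvydkoy2017, Thm. 1.2; Tao2011, Lemma 4.1 (i)]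
-/

noncomputable section

open MeasureTheory Set Function Metric Filter Topology Literature.Analysis.FluidPDE
open scoped ENNReal NNReal RealInnerProductSpace

namespace Summit.NavierStokesRegularity.NavierStokesRegularity.Theorems.TypeITraceScarL3

/-- **No local `L²` concentration at the final time under a Morrey bound, unit viscosity.**  For
`(u,p)` classical on `[0,T)`, Leray–Hopf on `[0,T]` (`ν = 1`), with `∫_{B(x,ρ)} |u(t)|² ≤ M₀ ρ` for all
`T_M < t < T`, `0 < ρ ≤ r_M` and every centre `x`: for every `x₀`, `R` and `θ > 0` there is `t₀ < T` with
`∫_{B(x₀,R)} |u(t) − u(T)|² ≤ θ` for `t ∈ (t₀,T)`.  (The Type-I-in-time theorem `localEnergy_sub_top_le_unit`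
is the case `morrey_of_typeI`.)  [cite: CaffarelliKohnNirenberg1982, Thm B; AlbrittonBarker2019, Def. 2.1; Federer1969, 2.10.2] -/
theorem localEnergy_sub_top_le_of_morrey_unit {T : ℝ} (hT : 0 < T)
    {u : ℝ → EuclideanSpace ℝ (Fin 3) → EuclideanSpace ℝ (Fin 3)}
    {p : ℝ → EuclideanSpace ℝ (Fin 3) → ℝ}
    (hcl : IsClassicalNSSolutionOn (Ico 0 T) 1 0 u p) (hLH : IsLerayHopfOn T 1 0 (u 0) u)
    {rM M₀ TM : ℝ} (hrM : 0 < rM) (hTM : TM < T)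
    (hmorB : ∀ t ∈ Ioo TM T, ∀ (x₁ : EuclideanSpace ℝ (Fin 3)) (ρ : ℝ), 0 < ρ → ρ ≤ rM →
      ∫ x in ball x₁ ρ, ‖u t x‖ ^ 2 ≤ M₀ * ρ)
    (x₀ : EuclideanSpace ℝ (Fin 3)) (R : ℝ) {θ : ℝ} (hθ : 0 < θ) :
    ∃ t₀ : ℝ, t₀ < T ∧ ∀ t ∈ Ioo t₀ T,
      ∫⁻ z in ball x₀ R, ‖u t z - u T z‖ₑ ^ 2 ≤ ENNReal.ofReal θ := by
  classical
  -- ### the Morrey bound near `T`, about every centre (hypothesis)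
  set M : ℝ := max M₀ 0 with hM_def
  have hM0 : 0 ≤ M := le_max_right _ _
  set T₁ : ℝ := max TM (T / 2) with hT₁
  have hT₁T : T₁ < T := max_lt hTM (by linarith)
  have hT₁0 : 0 ≤ T₁ := le_trans (by linarith) (le_max_right _ _)
  have hmor : ∀ t ∈ Ioo T₁ T, ∀ (x₁ : EuclideanSpace ℝ (Fin 3)) (r : ℝ), 0 < r → r ≤ rM →
      ∫ x in ball x₁ r, ‖u t x‖ ^ 2 ≤ M * r := by
    intro t ht x₁ r hr hrr
    have ht' : t ∈ Ioo TM T := ⟨(le_max_left _ _).trans_lt ht.1, ht.2⟩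
    exact (hmorB t ht' x₁ r hr hrr).trans (mul_le_mul_of_nonneg_right (le_max_left _ _) hr.le)
  have hmorE : ∀ t ∈ Ioo T₁ T, ∀ (x₁ : EuclideanSpace ℝ (Fin 3)) (r : ℝ), 0 < r → r ≤ rM →
      ∫⁻ x in ball x₁ r, ‖u t x‖ₑ ^ 2 ≤ ENNReal.ofReal (M * r) := by
    intro t ht x₁ r hr hrr
    rw [lintegral_ball_enorm_sq_eq_ofReal (hLH.memLp t ⟨hT₁0.trans ht.1.le, ht.2.le⟩)]
    exact ENNReal.ofReal_le_ofReal (hmor t ht x₁ r hr hrr)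
  have hmorT : ∀ (x₁ : EuclideanSpace ℝ (Fin 3)) (r : ℝ), 0 < r → r ≤ rM →
      ∫⁻ x in ball x₁ r, ‖u T x‖ₑ ^ 2 ≤ ENNReal.ofReal (M * r) := fun x₁ r hr hrr =>
    lintegral_ball_top_le_of_morrey hT hLH hT₁T hT₁0 x₁ fun t ht => hmor t ht x₁ r hr hrr
  -- ### the compact `ℋ¹`-null top singular set in the closed ball and its small cover
  set Sing : Set (EuclideanSpace ℝ (Fin 3)) := {x : EuclideanSpace ℝ (Fin 3) |
    IsBackwardSingularPoint u ((T, x) : ℝ × EuclideanSpace ℝ (Fin 3))} with hSing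
  have hKc : IsCompact (Sing ∩ closedBall x₀ R) :=
    (isCompact_closedBall x₀ R).of_isClosed_subset
      ((isClosed_topSingularSet_at u T).inter isClosed_closedBall) inter_subset_right
  have hK0 : μH[1] (Sing ∩ closedBall x₀ R) = 0 :=
    hausdorffMeasure_topSingularSet_inter_closedBall_eq_zero hT hcl hLH x₀ R
  have hγpos : 0 < ENNReal.ofReal (θ / (64 * (M + 1))) := by
    rw [ENNReal.ofReal_pos]; positivity
  have hγlt : μH[1] (Sing ∩ closedBall x₀ R) < ENNReal.ofReal (θ / (64 * (M + 1))) := by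
    rw [hK0]; exact hγpos
  obtain ⟨S, x, ρ, hρ, hKcov, hsum⟩ :=
    Literature.Geometry.GeometricMeasureTheory.exists_finset_ball_cover_of_hausdorffMeasure_lt
      one_pos hKc hγlt ENNReal.ofReal_ne_top hrM
  have h4 : (2 : ℝ≥0∞) ^ ((1 : ℝ) + 1) = 4 := by
    rw [show ((1 : ℝ) + 1) = ((2 : ℕ) : ℝ) by norm_num, ENNReal.rpow_natCast]; norm_num
  have hsum' : ∑ n ∈ S, ENNReal.ofReal (ρ n) ≤ 8 * ENNReal.ofReal (θ / (64 * (M + 1))) := by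
    have h1 : ∑ n ∈ S, ENNReal.ofReal (ρ n) = ∑ n ∈ S, ENNReal.ofReal (ρ n) ^ (1 : ℝ) := by
      simp only [ENNReal.rpow_one]
    rw [h1]
    refine hsum.trans (le_of_eq ?_)
    rw [h4, ← mul_assoc]
    norm_num
  -- energy of `u(t) − u(T)` on the singular cover: `≤ 4M Σ ρₙ ≤ θ/2`
  have hcoverE : ∀ t ∈ Ioo T₁ T,
      ∑ n ∈ S, ∫⁻ z in ball (x n) (ρ n), ‖u t z - u T z‖ₑ ^ 2 ≤ ENNReal.ofReal (θ / 2) := by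
    intro t ht
    have hball : ∀ n ∈ S, ∫⁻ z in ball (x n) (ρ n), ‖u t z - u T z‖ₑ ^ 2 ≤
        ENNReal.ofReal (4 * M) * ENNReal.ofReal (ρ n) := by
      intro n hn
      have hρn := hρ n hn
      have htIcc : t ∈ Icc 0 T := ⟨hT₁0.trans ht.1.le, ht.2.le⟩
      have hmeas : AEMeasurable (fun z => 2 * ‖u t z‖ₑ ^ 2) (volume.restrict (ball (x n) (ρ n))) :=
        ((((hLH.memLp t htIcc).aestronglyMeasurable.aemeasurable.enorm.pow_const 2).const_mul 2)).restrict
      have hMρ : 0 ≤ M * ρ n := mul_nonneg hM0 hρn.1.le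
      calc ∫⁻ z in ball (x n) (ρ n), ‖u t z - u T z‖ₑ ^ 2
          ≤ ∫⁻ z in ball (x n) (ρ n), (2 * ‖u t z‖ₑ ^ 2 + 2 * ‖u T z‖ₑ ^ 2) :=
            lintegral_mono fun z => enorm_sub_sq_le _ _
        _ = (2 * ∫⁻ z in ball (x n) (ρ n), ‖u t z‖ₑ ^ 2) + 2 * ∫⁻ z in ball (x n) (ρ n), ‖u T z‖ₑ ^ 2 := by
            rw [lintegral_add_left' hmeas, lintegral_const_mul' _ _ ENNReal.ofNat_ne_top,
              lintegral_const_mul' _ _ ENNReal.ofNat_ne_top]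
        _ ≤ 2 * ENNReal.ofReal (M * ρ n) + 2 * ENNReal.ofReal (M * ρ n) := by
            gcongr
            · exact hmorE t ht (x n) (ρ n) hρn.1 hρn.2
            · exact hmorT (x n) (ρ n) hρn.1 hρn.2
        _ = ENNReal.ofReal (4 * M) * ENNReal.ofReal (ρ n) := by
            rw [show (2 : ℝ≥0∞) = ENNReal.ofReal 2 by norm_num, ← ENNReal.ofReal_mul (by norm_num),
              ← ENNReal.ofReal_add (by positivity) (by positivity), ← ENNReal.ofReal_mul (by positivity)]
            congr 1
            ring
    calc ∑ n ∈ S, ∫⁻ z in ball (x n) (ρ n), ‖u t z - u T z‖ₑ ^ 2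
        ≤ ∑ n ∈ S, ENNReal.ofReal (4 * M) * ENNReal.ofReal (ρ n) := Finset.sum_le_sum hball
      _ = ENNReal.ofReal (4 * M) * ∑ n ∈ S, ENNReal.ofReal (ρ n) := by rw [Finset.mul_sum]
      _ ≤ ENNReal.ofReal (4 * M) * (8 * ENNReal.ofReal (θ / (64 * (M + 1)))) := by
          gcongr
      _ = ENNReal.ofReal (4 * M * (8 * (θ / (64 * (M + 1))))) := by
          rw [show (8 : ℝ≥0∞) = ENNReal.ofReal 8 by norm_num, ← ENNReal.ofReal_mul (by norm_num),
            ← ENNReal.ofReal_mul (by positivity)]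
      _ ≤ ENNReal.ofReal (θ / 2) := by
          refine ENNReal.ofReal_le_ofReal ?_
          have hMpos : 0 < M + 1 := by positivity
          rw [show 4 * M * (8 * (θ / (64 * (M + 1)))) = (M / (M + 1)) * (θ / 2) by field_simp; ring]
          have hle : M / (M + 1) ≤ 1 := by rw [div_le_one hMpos]; linarith
          nlinarith [hle, hθ, div_nonneg hM0 hMpos.le]
  -- ### the compact regular remainder and its finite cover by regular balls
  have hOo : IsOpen (⋃ n ∈ S, ball (x n) (ρ n)) := isOpen_biUnion fun _ _ => isOpen_ball
  have hK'c : IsCompact (closedBall x₀ R \ ⋃ n ∈ S, ball (x n) (ρ n)) :=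
    (isCompact_closedBall _ _).diff hOo
  have hreg : ∀ y ∈ closedBall x₀ R \ ⋃ n ∈ S, ball (x n) (ρ n),
      ∃ r : ℝ, 0 < r ∧ ∀ θ' : ℝ, 0 < θ' → ∃ t₀ : ℝ, t₀ < T ∧ ∀ t ∈ Ioo t₀ T,
        ∫⁻ z in ball y r, ‖u t z - u T z‖ₑ ^ 2 ≤ ENNReal.ofReal θ' := by
    rintro y ⟨hyR, hyO⟩
    refine localEnergy_sub_top_le_of_regular_unit hT hcl hLH fun hsing => ?_
    exact hyO (hKcov ⟨hsing, hyR⟩)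
  choose! rr hrr hθy using hreg
  obtain ⟨Tf, hTsub, hTcov⟩ : ∃ Tf : Finset (EuclideanSpace ℝ (Fin 3)),
      (↑Tf : Set (EuclideanSpace ℝ (Fin 3))) ⊆ closedBall x₀ R \ ⋃ n ∈ S, ball (x n) (ρ n) ∧
      closedBall x₀ R \ ⋃ n ∈ S, ball (x n) (ρ n) ⊆ ⋃ y ∈ Tf, ball y (rr y) := by
    obtain ⟨b', hb'sub, hb'fin, hb'cov⟩ := hK'c.elim_finite_subcover_image
      (b := closedBall x₀ R \ ⋃ n ∈ S, ball (x n) (ρ n))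
      (c := fun y => ball y (rr y)) (fun _ _ => isOpen_ball)
      (fun y hy => mem_biUnion hy (mem_ball_self (hrr y hy)))
    refine ⟨hb'fin.toFinset, by rwa [Set.Finite.coe_toFinset], ?_⟩
    simpa only [Set.Finite.mem_toFinset] using hb'cov
  have hθ₁pos : 0 < θ / (2 * ((Tf.card : ℝ) + 1)) := by positivity
  obtain ⟨t₂, ht₂, hRegular⟩ : ∃ t₂ : ℝ, t₂ < T ∧ ∀ t ∈ Ioo t₂ T, ∀ y ∈ Tf,
      ∫⁻ z in ball y (rr y), ‖u t z - u T z‖ₑ ^ 2 ≤ ENNReal.ofReal (θ / (2 * ((Tf.card : ℝ) + 1))) :=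
    exists_lt_forall_Ioo_finset Tf fun y hy => hθy y (hTsub hy) _ hθ₁pos
  refine ⟨max T₁ t₂, max_lt hT₁T ht₂, fun t ht => ?_⟩
  have htT₁ : t ∈ Ioo T₁ T := ⟨(le_max_left _ _).trans_lt ht.1, ht.2⟩
  have htt₂ : t ∈ Ioo t₂ T := ⟨(le_max_right _ _).trans_lt ht.1, ht.2⟩
  -- ### assemble
  have hballsub : ball x₀ R ⊆ (⋃ n ∈ S, ball (x n) (ρ n)) ∪ ⋃ y ∈ Tf, ball y (rr y) := by
    intro z hz
    by_cases hzO : z ∈ ⋃ n ∈ S, ball (x n) (ρ n)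
    · exact Or.inl hzO
    · exact Or.inr (hTcov ⟨ball_subset_closedBall hz, hzO⟩)
  have hcard : (Tf.card : ℝ≥0∞) * ENNReal.ofReal (θ / (2 * ((Tf.card : ℝ) + 1))) ≤
      ENNReal.ofReal (θ / 2) := by
    rw [← ENNReal.ofReal_natCast, ← ENNReal.ofReal_mul (Nat.cast_nonneg _)]
    refine ENNReal.ofReal_le_ofReal ?_
    have h2 : 0 < 2 * ((Tf.card : ℝ) + 1) := by positivity
    rw [← mul_div_assoc, div_le_iff₀ h2]
    nlinarith [hθ, Nat.cast_nonneg (α := ℝ) Tf.card]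
  calc ∫⁻ z in ball x₀ R, ‖u t z - u T z‖ₑ ^ 2
      ≤ ∫⁻ z in (⋃ n ∈ S, ball (x n) (ρ n)) ∪ ⋃ y ∈ Tf, ball y (rr y), ‖u t z - u T z‖ₑ ^ 2 :=
        lintegral_mono_set hballsub
    _ ≤ (∫⁻ z in ⋃ n ∈ S, ball (x n) (ρ n), ‖u t z - u T z‖ₑ ^ 2) +
          ∫⁻ z in ⋃ y ∈ Tf, ball y (rr y), ‖u t z - u T z‖ₑ ^ 2 := lintegral_union_le _ _ _
    _ ≤ (∑ n ∈ S, ∫⁻ z in ball (x n) (ρ n), ‖u t z - u T z‖ₑ ^ 2) +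
          ∑ y ∈ Tf, ∫⁻ z in ball y (rr y), ‖u t z - u T z‖ₑ ^ 2 :=
        add_le_add (lintegral_biUnion_finset_le _ _ _ _) (lintegral_biUnion_finset_le _ _ _ _)
    _ ≤ ENNReal.ofReal (θ / 2) + ∑ _y ∈ Tf, ENNReal.ofReal (θ / (2 * ((Tf.card : ℝ) + 1))) :=
        add_le_add (hcoverE t htT₁) (Finset.sum_le_sum (hRegular t htt₂))
    _ = ENNReal.ofReal (θ / 2) + (Tf.card : ℝ≥0∞) * ENNReal.ofReal (θ / (2 * ((Tf.card : ℝ) + 1))) := by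
        rw [Finset.sum_const, nsmul_eq_mul]
    _ ≤ ENNReal.ofReal (θ / 2) + ENNReal.ofReal (θ / 2) := add_le_add le_rfl hcard
    _ = ENNReal.ofReal θ := by
        rw [← ENNReal.ofReal_add (by positivity) (by positivity), add_halves]

/-- **No local `L²` concentration at the final time under a Morrey bound, every viscosity** (Tao's
normalisation `v = ν⁻¹u(·/ν)`: the Morrey bound transports with constant `ν⁻²M₀` on the window
`(νT_M, νT)`). [cite: Tao2011, footnote 3; CaffarelliKohnNirenberg1982, Thm B] -/
theorem localEnergy_sub_top_le_of_morrey {ν T : ℝ} (hν : 0 < ν) (hT : 0 < T)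
    {u : ℝ → EuclideanSpace ℝ (Fin 3) → EuclideanSpace ℝ (Fin 3)}
    {p : ℝ → EuclideanSpace ℝ (Fin 3) → ℝ}
    (hcl : IsClassicalNSSolutionOn (Set.Ico 0 T) ν 0 u p) (hLH : IsLerayHopfOn T ν 0 (u 0) u)
    {rM M₀ TM : ℝ} (hrM : 0 < rM) (hTM : TM < T)
    (hmorB : ∀ t ∈ Ioo TM T, ∀ (x₁ : EuclideanSpace ℝ (Fin 3)) (ρ : ℝ), 0 < ρ → ρ ≤ rM →
      ∫ x in ball x₁ ρ, ‖u t x‖ ^ 2 ≤ M₀ * ρ)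
    (x₀ : EuclideanSpace ℝ (Fin 3)) (R : ℝ) {θ : ℝ} (hθ : 0 < θ) :
    ∃ t₀ : ℝ, t₀ < T ∧ ∀ t ∈ Ioo t₀ T,
      ∫⁻ z in ball x₀ R, ‖u t z - u T z‖ₑ ^ 2 ≤ ENNReal.ofReal θ := by
  have hν0 : ν ≠ 0 := hν.ne'
  have hνi : 0 < ν⁻¹ := inv_pos.2 hν
  have hνT : 0 < ν * T := mul_pos hν hT
  set v : ℝ → EuclideanSpace ℝ (Fin 3) → EuclideanSpace ℝ (Fin 3) := timeRescale ν⁻¹ ν⁻¹ u with hv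
  set pv : ℝ → EuclideanSpace ℝ (Fin 3) → ℝ := timeRescale ν⁻¹ (ν⁻¹ ^ 2) p with hpv
  have hmaps : MapsTo (fun s => ν⁻¹ * s) (Ico 0 (ν * T)) (Ico 0 T) := by
    intro s hs
    refine ⟨mul_nonneg hνi.le hs.1, ?_⟩
    calc ν⁻¹ * s < ν⁻¹ * (ν * T) := mul_lt_mul_of_pos_left hs.2 hνi
      _ = T := by rw [← mul_assoc, inv_mul_cancel₀ hν0, one_mul]
  have hclv : IsClassicalNSSolutionOn (Ico 0 (ν * T)) 1 0 v pv := by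
    have h := hcl.viscosityRescale_set hν0 hmaps (uniqueDiffOn_Ico 0 (ν * T))
    rwa [timeRescale_zero_force] at h
  have hv0 : ν⁻¹ • u 0 = v 0 := by
    funext x
    simp [hv]
  have hLHv : IsLerayHopfOn (ν * T) 1 0 (v 0) v := by
    have h := hLH.viscosityRescale hνi
    have e1 : T / ν⁻¹ = ν * T := by rw [div_inv_eq_mul, mul_comm]
    rwa [e1, inv_mul_cancel₀ hν0, timeRescale_zero_force, hv0] at h
  have e0 : ν⁻¹ * (ν * T) = T := by rw [← mul_assoc, inv_mul_cancel₀ hν0, one_mul]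
  -- the Morrey bound of `v` on the window `(νT_M, νT)` with constant `ν⁻² M₀`
  have hTMv : ν * TM < ν * T := mul_lt_mul_of_pos_left hTM hν
  have hmorV : ∀ s ∈ Ioo (ν * TM) (ν * T), ∀ (x₁ : EuclideanSpace ℝ (Fin 3)) (ρ : ℝ), 0 < ρ → ρ ≤ rM →
      ∫ x in ball x₁ ρ, ‖v s x‖ ^ 2 ≤ ν⁻¹ ^ 2 * M₀ * ρ := by
    intro s hs x₁ ρ hρ hρM
    have ht : ν⁻¹ * s ∈ Ioo TM T := by
      constructor
      · have h := mul_lt_mul_of_pos_left hs.1 hνi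
        rwa [← mul_assoc, inv_mul_cancel₀ hν0, one_mul] at h
      · have h := mul_lt_mul_of_pos_left hs.2 hνi
        rwa [e0] at h
    have key := hmorB (ν⁻¹ * s) ht x₁ ρ hρ hρM
    have e1 : (fun x => ‖v s x‖ ^ 2) = fun x => ν⁻¹ ^ 2 * ‖u (ν⁻¹ * s) x‖ ^ 2 := by
      funext x
      rw [hv, timeRescale_apply, norm_smul, Real.norm_eq_abs, abs_of_pos hνi, mul_pow]
    rw [e1, integral_const_mul, mul_assoc]
    exact mul_le_mul_of_nonneg_left key (by positivity)
  -- the unit theorem for `v` at time `νT` with tolerance `ν⁻² θ`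
  have hθ' : 0 < ν⁻¹ ^ 2 * θ := by positivity
  obtain ⟨s₀, hs₀, hunit⟩ :=
    localEnergy_sub_top_le_of_morrey_unit hνT hclv hLHv hrM hTMv hmorV x₀ R hθ'
  refine ⟨ν⁻¹ * s₀, by nlinarith, fun t ht => ?_⟩
  have hs : ν * t ∈ Ioo s₀ (ν * T) := by
    constructor
    · have h := mul_lt_mul_of_pos_left ht.1 hν
      rwa [← mul_assoc, mul_inv_cancel₀ hν0, one_mul] at h
    · exact mul_lt_mul_of_pos_left ht.2 hν
  have key := hunit (ν * t) hs
  have e1 : (fun z => ‖v (ν * t) z - v (ν * T) z‖ₑ ^ 2) =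
      fun z => ‖ν⁻¹ • (u t z - u T z)‖ₑ ^ 2 := by
    funext z
    rw [hv, timeRescale_apply, timeRescale_apply, ← mul_assoc, inv_mul_cancel₀ hν0, one_mul, e0,
      smul_sub]
  rw [e1, lintegral_enorm_sq_const_smul, ENNReal.ofReal_mul (sq_nonneg _)] at key
  have hne0 : ENNReal.ofReal (ν⁻¹ ^ 2) ≠ 0 := by
    rw [ne_eq, ENNReal.ofReal_eq_zero, not_le]; positivity
  exact (ENNReal.mul_le_mul_iff_right hne0 ENNReal.ofReal_ne_top).1 key

/-- **`Tendsto` form under the Morrey bound**: `∫_{B(x₀,R)} |u(t) − u(T)|² → 0` as `t → T⁻` for a classical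
Leray–Hopf flow whose slices obey `∫_{B(x,ρ)} |u(t)|² ≤ M₀ρ` near `T` (Type I in the scaled-energy sense).
[cite: CaffarelliKohnNirenberg1982, Thm B; AlbrittonBarker2019, Def. 2.1] -/
theorem tendsto_localEnergy_sub_top_of_morrey {ν T : ℝ} (hν : 0 < ν) (hT : 0 < T)
    {u : ℝ → EuclideanSpace ℝ (Fin 3) → EuclideanSpace ℝ (Fin 3)}
    {p : ℝ → EuclideanSpace ℝ (Fin 3) → ℝ}
    (hcl : IsClassicalNSSolutionOn (Set.Ico 0 T) ν 0 u p) (hLH : IsLerayHopfOn T ν 0 (u 0) u)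
    {rM M₀ TM : ℝ} (hrM : 0 < rM) (hTM : TM < T)
    (hmorB : ∀ t ∈ Ioo TM T, ∀ (x₁ : EuclideanSpace ℝ (Fin 3)) (ρ : ℝ), 0 < ρ → ρ ≤ rM →
      ∫ x in ball x₁ ρ, ‖u t x‖ ^ 2 ≤ M₀ * ρ)
    (x₀ : EuclideanSpace ℝ (Fin 3)) (R : ℝ) :
    Tendsto (fun t => ∫⁻ z in ball x₀ R, ‖u t z - u T z‖ₑ ^ 2) (𝓝[<] T) (𝓝 0) := by
  rw [ENNReal.tendsto_nhds_zero]
  intro ε hε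
  rcases eq_or_ne ε ⊤ with rfl | hεtop
  · exact Eventually.of_forall fun _ => le_top
  obtain ⟨t₀, ht₀, h⟩ := localEnergy_sub_top_le_of_morrey hν hT hcl hLH hrM hTM hmorB x₀ R
    (ENNReal.toReal_pos hε.ne' hεtop)
  rw [← nhdsWithin_Ioo_eq_nhdsLT ht₀]
  filter_upwards [self_mem_nhdsWithin] with t ht
  exact (h t ht).trans (ENNReal.ofReal_toReal hεtop).le

end Summit.NavierStokesRegularity.NavierStokesRegularity.Theorems.TypeITraceScarL3

end
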